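import Literature.AlgebraicGeometry.Motives.UnitaryPeriodDomainConnected
import HarnessLib

/-!
# The centre of `SU(p, q)` is `{λ·1 : λ^{p+q} = 1}`, it is the kernel of the action on `I_{p,q}`,
# and `PSU(p, q) = SU(p, q)/Z(SU(p, q))` acts effectively on `I_{p,q}` (Viviani 2014, §2.1 Type `I_{p,q}`)

Layer `Literature/AlgebraicGeometry/Motives`, namespace `Literature.AlgebraicGeometry.Motives`; lane
`lit-hodgefound` (Track 2 foundations library), Layer A (period domain of abelian varieties of Weil
type; prover seat p13, generation 9, FILE 4 of the row «I_{p,q} is the homogeneous space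
SU(p,q)/S(U(p)×U(q))»). Sequel of `Motives/UnitaryPeriodDomainConnected` (FILE 3:
`smul_eq_self_of_eq_smul_one` — a scalar `λ·1 ∈ SU(p, q)` fixes every point of `I_{p,q}`), of
`Motives/UnitaryPeriodDomainProperAction` (FILE 1: `suCLM`, the blocks `cblock₁₂`, `cblock₂₂`,
`coe_smul_comp_smulDenom : (g • Z)(A₁₁ + A₁₂Z) = A₂₁ + A₂₂Z`, `apply_eq_cblocks`, `zeroPoint`) and of
`Motives/UnitaryPeriodDomainHomogeneous` (generation 8: the action `mulActionUnitaryPeriodDomain` and its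
transitivity `isPretransitive_unitaryPeriodDomain`), all consumed BY NAME; nothing is restated.

## Source, verbatim

F. Viviani, *A tour on Hermitian symmetric manifolds* (LNM 2108, 2014), §2.1 "Type `I_{p,q}`", held
`paper:arxiv-1310.3665` p0015 L39–L54: "The Lie group `SU(p,q)` acts transitively on `𝒟_{I_{p,q}}` via
generalized Möbius transformations […] Notice that the center `Z(SU(p,q)) = {λ I_{p+q} : λ^{p+q} = 1}` of
`SU(p,q)` acts trivially on `𝒟_{I_{p,q}}`; indeed, it turns out that the connected component of the group
of biholomorphisms of `𝒟_{I_{p,q}}` is given by `Hol(𝒟_{I_{p,q}})ᵒ = SU(p,q)/Z(SU(p,q)) =: PSU(p,q)`,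
which is the connected non-compact adjoint simple Lie group of type `A_{p+q-1}`."

## What is here (PROVED theorems and instances; definitions with bodies `blockScalarEquiv`,
`rootTwist`, `stdProjectiveSpecialUnitaryGroup`; no named fact, net debt 0)

Throughout `G = SU(p, q) = stdSpecialUnitaryGroup p q` acts on `I_{p,q} = unitaryPeriodDomain p q`.

* §1 `blockScalarEquiv a d = diag(a·1_p, d·1_q)` (`det = a^p d^q`), and for `ζ^{p+q+1} = 1` the element
  **`rootTwist ζ = diag(ζ^q·1_p, ζ^{q+1}·1_q) ∈ SU(p, q)`**, which acts on the ball by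
  `rootTwist ζ • Z = ζ Z` (`coe_rootTwist_smul`); consequence **`eq_zeroPoint_of_forall_stabilizer_smul_eq`**:
  `0` is the only point of `I_{p,q}` fixed by the whole stabiliser `Stab(0) = S(U(p) × U(q))`.
* §2 **`exists_eq_smul_of_forall_smul_eq`** (`p, q ≥ 1`): an element of `SU(p, q)` acting trivially on
  `I_{p,q}` is a scalar `λ·1` — the kernel of the action consists of scalars (polarising the identity
  `Z(A₁₁ + A₁₂Z) = A₂₁ + A₂₂Z` along `Z ↦ tZ` and testing on rank-one operators `v ↦ ⟪u, v⟫ y`); with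
  FILE 3's converse, `forall_smul_eq_iff`.
* §3 `pow_eq_one_of_forall_eq_smul` / `exists_forall_eq_smul_of_pow_eq_one`:
  **`λ·1 ∈ SU(p, q) ↔ λ^{p+q} = 1`** (`det(λ·1) = λ^{p+q}`; `|λ| = 1` is then automatic).
* §4 the centre: `mem_center_of_forall_eq_smul` (scalars are central), **`smul_eq_self_of_mem_center`**
  ("the center acts trivially" — for every `p, q`: a central `g` commutes with `Stab(0)`, so `g • 0` is
  `Stab(0)`-fixed, so `g • 0 = 0` by §1, and then `g • (h • 0) = h • (g • 0) = h • 0` by transitivity),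
  `center_le_ker`, and for `p, q ≥ 1` **`center_eq_ker`** (`Z(SU(p,q))` IS the kernel of
  `SU(p,q) → Bij(I_{p,q})`) and **`mem_center_iff`**:
  `g ∈ Z(SU(p,q)) ↔ ∃ λ, λ^{p+q} = 1 ∧ g = λ·1` — Viviani's "`Z(SU(p,q)) = {λ I_{p+q} : λ^{p+q} = 1}`" —
  and **`card_center`**: `|Z(SU(p,q))| = p + q` (`g ↦ λ` is a bijection onto `μ_{p+q}(ℂ)`).
* §5 `stdProjectiveSpecialUnitaryGroup p q = PSU(p, q) := SU(p, q) ⧸ Z(SU(p, q))` (as printed), the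
  descended action `instMulActionPSU` (`coe_smul : ↑g • Z = g • Z`), its transitivity, and
  **`instFaithfulSMulPSU`** (`p, q ≥ 1`, as `[NeZero p] [NeZero q]`): `PSU(p, q)` acts effectively
  (faithfully) on `I_{p,q}` — the injectivity half of "`Hol(𝒟_{I_{p,q}})ᵒ = PSU(p,q)`".

## Not here

That `PSU(p, q)` is the whole identity component of the biholomorphism group of `𝒟_{I_{p,q}}`
(surjectivity onto `Hol(𝒟)ᵒ`), adjointness / simplicity of `PSU(p, q)`, the centre of `SU(p, 0) = SU(p)`
(the action on the one-point `I_{p,0}` says nothing there). The Hodge conjecture is not addressed.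

## References

* [Viviani2013] F. Viviani, *A tour on Hermitian symmetric manifolds*, in: Combinatorial Algebraic
  Geometry (Levico Terme 2013), LNM 2108 (2014) 149–239, §2.1 Type `I_{p,q}` (arXiv:1310.3665, held copy
  p0015 L39–L54).
* [CarlsonMullerStachPeters2017] J. Carlson, S. Müller-Stach, C. Peters, *Period Mappings and Period
  Domains*, 2nd ed., §16.1 Prop. 16.1.3 (ii) (`M = Aut⁰(D)` is adjoint-type: centre-free action), Thm. 16.1.5
  (type AIII).
* [vanGeemen1994HodgeAV] B. van Geemen, LNM 1594 (1994), 5.9–5.11 (`SU(n,n)` and its action on `H_n`).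
-/

noncomputable section

open Module
open scoped InnerProductSpace ComplexConjugate

namespace Literature.AlgebraicGeometry.Motives

variable {p q : ℕ}

/-- Local shorthand for `ℂᵖ`. -/
local notation "Vp" => EuclideanSpace ℂ (Fin p)
/-- Local shorthand for `ℂ^q`. -/
local notation "Vq" => EuclideanSpace ℂ (Fin q)

/-! ## §1 The block-scalar elements `diag(ζ^q, ζ^{q+1})` of `SU(p, q)` and their action `Z ↦ ζZ` -/

section RootTwist

/-- The block-scalar automorphism `diag(a·1_p, d·1_q) : (v, w) ↦ (a v, d w)` of `ℂᵖ × ℂ^q` (`a, d ≠ 0`)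
— the shape `(A 0; 0 D)` of the elements of `S(U_p × U_q)` with scalar blocks.
[cite: Viviani2013, §2.1 Type I_{p,q} (`S(U_p × U_q) = {(A 0; 0 D)}`)] -/
def blockScalarEquiv (a d : ℂ) (ha : a ≠ 0) (hd : d ≠ 0) : (Vp × Vq) ≃ₗ[ℂ] (Vp × Vq) :=
  (LinearEquiv.smulOfNeZero ℂ Vp a ha).prodCongr (LinearEquiv.smulOfNeZero ℂ Vq d hd)

/-- `diag(a, d)(v, w) = (a v, d w)`. [cite: Viviani2013, §2.1 Type I_{p,q}] -/
@[simp] theorem blockScalarEquiv_apply (a d : ℂ) (ha : a ≠ 0) (hd : d ≠ 0) (x : Vp × Vq) :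
    blockScalarEquiv a d ha hd x = (a • x.1, d • x.2) := rfl

/-- As a linear map, `diag(a, d) = (a·id) × (d·id)`. [cite: Viviani2013, §2.1 Type I_{p,q}] -/
theorem coe_blockScalarEquiv (a d : ℂ) (ha : a ≠ 0) (hd : d ≠ 0) :
    ((blockScalarEquiv a d ha hd : (Vp × Vq) ≃ₗ[ℂ] (Vp × Vq)) : (Vp × Vq) →ₗ[ℂ] (Vp × Vq)) =
      (a • LinearMap.id : Vp →ₗ[ℂ] Vp).prodMap (d • LinearMap.id : Vq →ₗ[ℂ] Vq) :=
  LinearMap.ext fun _ => rfl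

/-- **`det diag(a·1_p, d·1_q) = a^p d^q`.** [cite: Viviani2013, §2.1 Type I_{p,q} (`det(A) det(D) = 1`)] -/
theorem det_blockScalarEquiv (a d : ℂ) (ha : a ≠ 0) (hd : d ≠ 0) :
    LinearMap.det ((blockScalarEquiv a d ha hd : (Vp × Vq) ≃ₗ[ℂ] (Vp × Vq)) :
      (Vp × Vq) →ₗ[ℂ] (Vp × Vq)) = a ^ p * d ^ q := by
  rw [coe_blockScalarEquiv, LinearMap.det_prodMap, LinearMap.det_smul, LinearMap.det_smul,
    LinearMap.det_id, mul_one, LinearMap.det_id, mul_one, finrank_euclideanSpace_fin, finrank_euclideanSpace_fin]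

/-- Unit scalars preserve the standard Hermitian form: `H₀((a v, d w), (a v', d w')) = H₀((v, w), (v', w'))`
for `|a| = |d| = 1`. [cite: Viviani2013, §2.1 Type I_{p,q} (`ĀᵗA = I_p`, `D̄ᵗD = I_q`)] -/
theorem stdHermitianForm_smul_smul {a d : ℂ} (ha : ‖a‖ = 1) (hd : ‖d‖ = 1) (x y : Vp × Vq) :
    stdHermitianForm p q (a • x.1, d • x.2) (a • y.1, d • y.2) = stdHermitianForm p q x y := by
  have ha' : conj a * a = 1 := by rw [Complex.conj_mul', ha]; norm_num
  have hd' : conj d * d = 1 := by rw [Complex.conj_mul', hd]; norm_num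
  simp only [stdHermitianForm, inner_smul_left, inner_smul_right]
  linear_combination ⟪x.1, y.1⟫_ℂ * ha' - ⟪x.2, y.2⟫_ℂ * hd'

/-- A root of unity of order dividing `p + q + 1` is non-zero. [cite: Viviani2013, §2.1 Type I_{p,q}] -/
theorem ne_zero_of_pow_succ_eq_one {ζ : ℂ} (hζ : ζ ^ (p + q + 1) = 1) : ζ ≠ 0 := by
  rintro rfl
  rw [zero_pow (Nat.succ_ne_zero _)] at hζ
  exact zero_ne_one hζ

/-- **The element `k_ζ = diag(ζ^q·1_p, ζ^{q+1}·1_q) ∈ SU(p, q)`** for `ζ^{p+q+1} = 1`: an isometry of `H₀`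
(`|ζ| = 1`) of determinant `ζ^{qp + (q+1)q} = (ζ^{p+q+1})^q = 1`; it lies in `S(U_p × U_q) = Stab(0)`.
[cite: Viviani2013, §2.1 Type I_{p,q} (`S(U_p × U_q) = {(A 0; 0 D) : ĀᵗA = I_p, D̄ᵗD = I_q, det(A)det(D) = 1}`)] -/
def rootTwist (ζ : ℂ) (hζ : ζ ^ (p + q + 1) = 1) : stdSpecialUnitaryGroup p q :=
  ⟨blockScalarEquiv (ζ ^ q) (ζ ^ (q + 1)) (pow_ne_zero _ (ne_zero_of_pow_succ_eq_one hζ))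
      (pow_ne_zero _ (ne_zero_of_pow_succ_eq_one hζ)), by
    have h1 : ‖ζ‖ = 1 := Complex.norm_eq_one_of_pow_eq_one hζ (Nat.succ_ne_zero _)
    refine mem_hermSpecialUnitaryGroup_iff.2 ⟨fun x y => ?_, ?_⟩
    · simp only [stdHermitianSesqForm_apply, blockScalarEquiv_apply]
      exact stdHermitianForm_smul_smul (by rw [norm_pow, h1, one_pow]) (by rw [norm_pow, h1, one_pow]) x y
    · rw [det_blockScalarEquiv, ← pow_mul, ← pow_mul, ← pow_add,
        show q * p + (q + 1) * q = (p + q + 1) * q by ring, pow_mul, hζ, one_pow]⟩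

/-- `k_ζ(v, w) = (ζ^q v, ζ^{q+1} w)`. [cite: Viviani2013, §2.1 Type I_{p,q}] -/
@[simp] theorem rootTwist_apply (ζ : ℂ) (hζ : ζ ^ (p + q + 1) = 1) (x : Vp × Vq) :
    ((rootTwist ζ hζ : stdSpecialUnitaryGroup p q) : (Vp × Vq) ≃ₗ[ℂ] (Vp × Vq)) x =
      (ζ ^ q • x.1, ζ ^ (q + 1) • x.2) := rfl

/-- **`k_ζ • Z = ζ Z`**: the Möbius action `Z ↦ (A₂₁ + A₂₂Z)(A₁₁ + A₁₂Z)⁻¹` of the block-scalar element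
is `Z ↦ ζ^{q+1} Z ζ^{-q} = ζ Z`. [cite: Viviani2013, §2.1 Type I_{p,q} (generalized Möbius transformations)] -/
theorem coe_rootTwist_smul (ζ : ℂ) (hζ : ζ ^ (p + q + 1) = 1) (Z : unitaryPeriodDomain p q) :
    ((rootTwist ζ hζ • Z : unitaryPeriodDomain p q) : Vp →L[ℂ] Vq) = ζ • (Z : Vp →L[ℂ] Vq) := by
  have h := coe_smul_comp_smulDenom (rootTwist ζ hζ) Z
  refine ContinuousLinearMap.ext fun v => ?_
  have hv := congrArg (fun T : Vp →L[ℂ] Vq => T v) h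
  simp only [ContinuousLinearMap.comp_apply, smulDenom, smulNum, add_apply,
    cblock₁₁_apply, cblock₁₂_apply, cblock₂₁_apply, cblock₂₂_apply, suCLM_apply, rootTwist_apply,
    smul_zero, add_zero, zero_add, map_smul] at hv
  -- `hv : ζ^q • (k_ζ • Z) v = ζ^(q+1) • Z v`
  rw [pow_succ, mul_smul] at hv
  rw [smul_apply]
  exact smul_right_injective _ (pow_ne_zero _ (ne_zero_of_pow_succ_eq_one hζ)) hv

/-- `k_ζ` fixes the base point: `k_ζ • 0 = 0`. [cite: Viviani2013, §2.1 Type I_{p,q} (`S(U_p × U_q)` = stabilizer of `0`)] -/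
theorem rootTwist_smul_zeroPoint (ζ : ℂ) (hζ : ζ ^ (p + q + 1) = 1) :
    rootTwist ζ hζ • zeroPoint p q = zeroPoint p q := by
  refine Subtype.ext (ContinuousLinearMap.ext fun v => ?_)
  rw [coe_rootTwist_smul, smul_apply]
  change ζ • ((0 : Vp →L[ℂ] Vq) v) = (0 : Vp →L[ℂ] Vq) v
  rw [zero_apply, smul_zero]

/-- `k_ζ ∈ Stab(0)`. [cite: Viviani2013, §2.1 Type I_{p,q} (`S(U_p × U_q)` = stabilizer of `0`)] -/
theorem rootTwist_mem_stabilizer (ζ : ℂ) (hζ : ζ ^ (p + q + 1) = 1) :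
    rootTwist ζ hζ ∈ MulAction.stabilizer (stdSpecialUnitaryGroup p q) (zeroPoint p q) :=
  rootTwist_smul_zeroPoint ζ hζ

/-- In a vector space, `c • x = x` with `c ≠ 1` forces `x = 0`. [cite: Viviani2013, §2.1 Type I_{p,q}] -/
theorem eq_zero_of_smul_eq_self {E : Type*} [AddCommGroup E] [Module ℂ E] {c : ℂ} (hc : c ≠ 1) {x : E}
    (h : c • x = x) : x = 0 := by
  have h2 : (c - 1) • x = 0 := by rw [sub_smul, one_smul, h, sub_self]
  exact (smul_eq_zero.1 h2).resolve_left (sub_ne_zero.2 hc)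

/-- If `ζ ≠ 1`, the only fixed point of `k_ζ` (`Z ↦ ζZ`) in `I_{p,q}` is `0`.
[cite: Viviani2013, §2.1 Type I_{p,q}] -/
theorem eq_zeroPoint_of_rootTwist_smul_eq {ζ : ℂ} (hζ : ζ ^ (p + q + 1) = 1) (hζ1 : ζ ≠ 1)
    {Z : unitaryPeriodDomain p q} (h : rootTwist ζ hζ • Z = Z) : Z = zeroPoint p q := by
  have h1 : ζ • (Z : Vp →L[ℂ] Vq) = (Z : Vp →L[ℂ] Vq) := by rw [← coe_rootTwist_smul ζ hζ Z, h]
  exact Subtype.ext (eq_zero_of_smul_eq_self hζ1 h1)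

/-- A primitive `(p+q+1)`-st root of unity: `ζ^{p+q+1} = 1`, and `ζ ≠ 1` as soon as `p + q ≥ 1`.
[cite: Viviani2013, §2.1 Type I_{p,q} (`λ^{p+q} = 1`)] -/
theorem exists_pow_succ_eq_one_and_ne_one :
    ∃ ζ : ℂ, ζ ^ (p + q + 1) = 1 ∧ (0 < p + q → ζ ≠ 1) :=
  ⟨Complex.exp (2 * Real.pi * Complex.I / (p + q + 1 : ℕ)),
    (Complex.isPrimitiveRoot_exp _ (Nat.succ_ne_zero _)).pow_eq_one,
    fun h => (Complex.isPrimitiveRoot_exp _ (Nat.succ_ne_zero _)).ne_one (by omega)⟩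

/-- **`0` is the only point of `I_{p,q}` fixed by the whole stabiliser `Stab(0) = S(U_p × U_q)`**
(already the one element `k_ζ ∈ Stab(0)`, `ζ = e^{2πi/(p+q+1)}`, moves every `Z ≠ 0`).
[cite: Viviani2013, §2.1 Type I_{p,q} (`S(U_p × U_q)` "is also equal to the stabilizer of `0`")] -/
theorem eq_zeroPoint_of_forall_stabilizer_smul_eq {Z : unitaryPeriodDomain p q}
    (hZ : ∀ k ∈ MulAction.stabilizer (stdSpecialUnitaryGroup p q) (zeroPoint p q), k • Z = Z) :
    Z = zeroPoint p q := by
  rcases Nat.eq_zero_or_pos (p + q) with h0 | hpos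
  · -- `p = 0`: `Hom(ℂ⁰, ℂ^q)` is a point
    have hp : p = 0 := by omega
    subst hp
    refine Subtype.ext (ContinuousLinearMap.ext fun v => ?_)
    have hv : v = 0 := Subsingleton.elim _ _
    rw [hv, map_zero, map_zero]
  · obtain ⟨ζ, hζ, hζ1⟩ := (exists_pow_succ_eq_one_and_ne_one : ∃ ζ : ℂ, ζ ^ (p + q + 1) = 1 ∧ _)
    exact eq_zeroPoint_of_rootTwist_smul_eq hζ (hζ1 hpos) (hZ _ (rootTwist_mem_stabilizer ζ hζ))

end RootTwist

/-! ## §2 The kernel of the action: an element acting trivially on `I_{p,q}` is a scalar -/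

section Kernel

/-- The rank-one operator `v ↦ ⟪u, v⟫ y : ℂᵖ → ℂ^q` (test operators for the block identities).
[cite: Viviani2013, §2.1 Type I_{p,q} (`𝒟_{I_{p,q}} ⊂ M_{p,q}(ℂ)`)] -/
def rankOneCLM (u : Vp) (y : Vq) : Vp →L[ℂ] Vq :=
  (innerSL ℂ u).smulRight y

/-- `rankOneCLM u y v = ⟪u, v⟫ y`. [cite: Viviani2013, §2.1 Type I_{p,q}] -/
@[simp] theorem rankOneCLM_apply (u : Vp) (y : Vq) (v : Vp) : rankOneCLM u y v = ⟪u, v⟫_ℂ • y := rfl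

/-- Small multiples of any operator lie in the ball: `‖t‖ ‖T‖ < 1 ⇒ tT ∈ I_{p,q}`.
[cite: Viviani2013, §2.1 Type I_{p,q} (`𝒟_{I_{p,q}}` is a bounded domain containing `0`)] -/
theorem smul_mem_unitaryPeriodDomain_of_norm_mul_lt (T : Vp →L[ℂ] Vq) {t : ℂ} (ht : ‖t‖ * ‖T‖ < 1) :
    t • T ∈ unitaryPeriodDomain p q := by
  rw [unitaryPeriodDomain_eq_ball, Metric.mem_ball, dist_zero_right, norm_smul]
  exact ht

/-- Every operator `T` has a non-zero multiple `εT` with `εT, (ε/2)T ∈ I_{p,q}`.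
[cite: Viviani2013, §2.1 Type I_{p,q}] -/
theorem exists_smul_mem_unitaryPeriodDomain (T : Vp →L[ℂ] Vq) :
    ∃ ε : ℂ, ε ≠ 0 ∧ ε • T ∈ unitaryPeriodDomain p q ∧ (ε / 2) • T ∈ unitaryPeriodDomain p q := by
  set r : ℝ := ‖T‖ + 1 with hr
  have hr0 : 0 < r := by positivity
  have hrC : ‖((r : ℂ))⁻¹‖ = r⁻¹ := by rw [norm_inv, Complex.norm_real, Real.norm_of_nonneg hr0.le]
  have h1 : r⁻¹ * ‖T‖ < 1 := by
    rw [inv_mul_lt_iff₀ hr0, mul_one, hr]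
    exact lt_add_one _
  refine ⟨((r : ℂ))⁻¹, inv_ne_zero (by exact_mod_cast hr0.ne'), ?_, ?_⟩
  · exact smul_mem_unitaryPeriodDomain_of_norm_mul_lt T (by rwa [hrC])
  · refine smul_mem_unitaryPeriodDomain_of_norm_mul_lt T ?_
    rw [norm_div, hrC, Complex.norm_two]
    have h0 : 0 ≤ r⁻¹ * ‖T‖ := by positivity
    calc r⁻¹ / 2 * ‖T‖ = (r⁻¹ * ‖T‖) / 2 := by ring
      _ < 1 := by linarith

/-- Linear algebra: if `εX + ε²Y = 0` and `(ε/2)X + (ε/2)²Y = 0` with `ε ≠ 0` then `X = Y = 0`.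
[cite: Viviani2013, §2.1 Type I_{p,q}] -/
theorem eq_zero_and_eq_zero_of_smul_add_sq_smul {E : Type*} [AddCommGroup E] [Module ℂ E] {X Y : E}
    {ε : ℂ} (hε : ε ≠ 0) (h1 : ε • X + ε ^ 2 • Y = 0) (h2 : (ε / 2) • X + (ε / 2) ^ 2 • Y = 0) :
    X = 0 ∧ Y = 0 := by
  have e1 : X + ε • Y = 0 := by
    have : ε • (X + ε • Y) = 0 := by rw [smul_add, smul_smul, ← sq]; exact h1
    exact (smul_eq_zero.1 this).resolve_left hε
  have e2 : X + (ε / 2) • Y = 0 := by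
    have : (ε / 2) • (X + (ε / 2) • Y) = 0 := by rw [smul_add, smul_smul, ← sq]; exact h2
    exact (smul_eq_zero.1 this).resolve_left (div_ne_zero hε two_ne_zero)
  have e3 : (ε - ε / 2) • Y = (X + ε • Y) - (X + (ε / 2) • Y) := by rw [sub_smul]; abel
  rw [e1, e2, sub_zero, sub_half] at e3
  have hY : Y = 0 := (smul_eq_zero.1 e3).resolve_left (div_ne_zero hε two_ne_zero)
  rw [hY, smul_zero, add_zero] at e1
  exact ⟨e1, hY⟩

/-- **Block identities of a trivially-acting element.** If `g • Z = Z` for every `Z ∈ I_{p,q}`, then, with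
`g = (A₁₁ A₁₂; A₂₁ A₂₂)`: `A₂₁ = 0`, `A₁₂ = 0`, and `T A₁₁ = A₂₂ T` for every operator `T : ℂᵖ → ℂ^q`
(from `Z(A₁₁ + A₁₂Z) = A₂₁ + A₂₂Z` at `Z = 0`, then polarised along `Z = tT`, then tested on the rank-one
operators `v ↦ ⟪A₁₂y, v⟫ y`). [cite: Viviani2013, §2.1 Type I_{p,q} (the Möbius action; "acts trivially")] -/
theorem cblocks_of_forall_smul_eq (g : stdSpecialUnitaryGroup p q)
    (hg : ∀ Z : unitaryPeriodDomain p q, g • Z = Z) :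
    cblock₂₁ (suCLM g) = 0 ∧ cblock₁₂ (suCLM g) = 0 ∧
      ∀ T : Vp →L[ℂ] Vq, T.comp (cblock₁₁ (suCLM g)) = (cblock₂₂ (suCLM g)).comp T := by
  set A := suCLM g with hA
  -- the basic identity `Z(A₁₁ + A₁₂Z) = A₂₁ + A₂₂Z` for `Z` in the ball
  have key : ∀ Z : unitaryPeriodDomain p q,
      (Z : Vp →L[ℂ] Vq).comp (cblock₁₁ A + (cblock₁₂ A).comp (Z : Vp →L[ℂ] Vq)) =
        cblock₂₁ A + (cblock₂₂ A).comp (Z : Vp →L[ℂ] Vq) := by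
    intro Z
    have h := coe_smul_comp_smulDenom g Z
    rw [hg Z] at h
    exact h
  have h21 : cblock₂₁ A = 0 := by
    have h := key (zeroPoint p q)
    simp only [ContinuousLinearMap.zero_comp, ContinuousLinearMap.comp_zero, add_zero] at h
    exact h.symm
  -- polarisation along `Z = tT`
  have hXY : ∀ T : Vp →L[ℂ] Vq,
      T.comp (cblock₁₁ A) = (cblock₂₂ A).comp T ∧ T.comp ((cblock₁₂ A).comp T) = 0 := by
    intro T
    obtain ⟨ε, hε, hm1, hm2⟩ := exists_smul_mem_unitaryPeriodDomain T
    set X := T.comp (cblock₁₁ A) - (cblock₂₂ A).comp T with hX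
    set Y := T.comp ((cblock₁₂ A).comp T) with hY
    have expand : ∀ t : ℂ,
        (t • T).comp (cblock₁₁ A + (cblock₁₂ A).comp (t • T)) - (cblock₂₁ A + (cblock₂₂ A).comp (t • T)) =
          t • X + t ^ 2 • Y := by
      intro t
      rw [h21, hX, hY]
      simp only [ContinuousLinearMap.comp_add, ContinuousLinearMap.smul_comp, ContinuousLinearMap.comp_smul,
        zero_add, smul_sub, sq, mul_smul]
      abel
    have e1 : ε • X + ε ^ 2 • Y = 0 := by
      rw [← expand ε, sub_eq_zero]
      exact key ⟨ε • T, hm1⟩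
    have e2 : (ε / 2) • X + (ε / 2) ^ 2 • Y = 0 := by
      rw [← expand (ε / 2), sub_eq_zero]
      exact key ⟨(ε / 2) • T, hm2⟩
    obtain ⟨hX0, hY0⟩ := eq_zero_and_eq_zero_of_smul_add_sq_smul hε e1 e2
    exact ⟨sub_eq_zero.1 hX0, hY0⟩
  -- `A₁₂ = 0` by testing on `v ↦ ⟪A₁₂ y, v⟫ y`
  have h12 : cblock₁₂ A = 0 := by
    refine ContinuousLinearMap.ext fun y => ?_
    rw [zero_apply]
    set u := cblock₁₂ A y with hu
    have h := congrArg (fun S : Vp →L[ℂ] Vq => S u) (hXY (rankOneCLM u y)).2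
    have huu : rankOneCLM u y u = (⟪u, u⟫_ℂ) • y := rfl
    simp only [ContinuousLinearMap.comp_apply, zero_apply, huu, map_smul, ← hu] at h
    -- `h : ⟪u,u⟫ • ⟪u,u⟫ • y = 0`
    rw [smul_smul, smul_eq_zero] at h
    rcases h with h | hy
    · have h' : (⟪u, u⟫_ℂ : ℂ) = 0 := by rcases mul_eq_zero.1 h with h | h <;> exact h
      exact inner_self_eq_zero.1 h'
    · rw [hu, hy, map_zero]
  exact ⟨h21, h12, fun T => (hXY T).1⟩

/-- **The kernel of `SU(p, q) → Bij(I_{p,q})` consists of scalars** (`p, q ≥ 1`): if `g • Z = Z` for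
all `Z ∈ I_{p,q}` then `g = λ·1` for some `λ ∈ ℂ` (from §2's `T A₁₁ = A₂₂ T` for all `T`, tested on
rank-one operators: `A₂₂ = λ·1_q` with `λ = ⟪e₁, A₁₁e₁⟫`, then `⟪u, A₁₁v⟫ = λ⟪u, v⟫`).
[cite: Viviani2013, §2.1 Type I_{p,q} ("`Hol(𝒟_{I_{p,q}})ᵒ = SU(p,q)/Z(SU(p,q))`", `Z(SU(p,q)) = {λ I_{p+q}}`)] -/
theorem exists_eq_smul_of_forall_smul_eq (hp : 0 < p) (hq : 0 < q) (g : stdSpecialUnitaryGroup p q)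
    (hg : ∀ Z : unitaryPeriodDomain p q, g • Z = Z) :
    ∃ c : ℂ, ∀ x : Vp × Vq,
      (g : (Vp × Vq) ≃ₗ[ℂ] (Vp × Vq)) x = c • x := by
  obtain ⟨h21, h12, hcomm⟩ := cblocks_of_forall_smul_eq g hg
  set A := suCLM g with hA
  set u₀ : Vp := EuclideanSpace.single (⟨0, hp⟩ : Fin p) (1 : ℂ) with hu₀
  set y₀ : Vq := EuclideanSpace.single (⟨0, hq⟩ : Fin q) (1 : ℂ) with hy₀
  have hu₀n : ‖u₀‖ = 1 := by rw [hu₀, PiLp.norm_single, norm_one]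
  have hu₀1 : (⟪u₀, u₀⟫_ℂ : ℂ) = 1 := by
    rw [inner_self_eq_norm_sq_to_K, hu₀n]; norm_num
  have hy₀n : ‖y₀‖ = 1 := by rw [hy₀, PiLp.norm_single, norm_one]
  have hy₀0 : y₀ ≠ 0 := by
    intro h
    rw [h, norm_zero] at hy₀n
    exact zero_ne_one hy₀n
  set c : ℂ := ⟪u₀, cblock₁₁ A u₀⟫_ℂ with hc
  -- `A₂₂ = c·1`
  have h22 : ∀ y : Vq, cblock₂₂ A y = c • y := by
    intro y
    have h := congrArg (fun S : Vp →L[ℂ] Vq => S u₀) (hcomm (rankOneCLM u₀ y))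
    simp only [ContinuousLinearMap.comp_apply, rankOneCLM_apply, hu₀1, one_smul] at h
    exact h.symm
  -- `A₁₁ = c·1`
  have h11 : ∀ v : Vp, cblock₁₁ A v = c • v := by
    intro v
    refine ext_inner_left ℂ fun u => ?_
    have h := congrArg (fun S : Vp →L[ℂ] Vq => S v) (hcomm (rankOneCLM u y₀))
    simp only [ContinuousLinearMap.comp_apply, rankOneCLM_apply, h22, smul_smul] at h
    -- `h : ⟪u, A₁₁ v⟫ • y₀ = (c * ⟪u, v⟫) • y₀`
    have h' : (⟪u, cblock₁₁ A v⟫_ℂ - c * ⟪u, v⟫_ℂ) • y₀ = 0 := by rw [sub_smul, h, sub_self]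
    rcases smul_eq_zero.1 h' with h'' | h''
    · rw [sub_eq_zero.1 h'', inner_smul_right]
    · exact absurd h'' hy₀0
  refine ⟨c, fun x => ?_⟩
  have hx := apply_eq_cblocks A x.1 x.2
  rw [h21, h12, h11, h22, zero_apply, zero_apply, add_zero, zero_add] at hx
  exact hx

/-- **`g` acts trivially on `I_{p,q}` iff `g` is a scalar** (`p, q ≥ 1`; `⇐` is FILE 3's
`smul_eq_self_of_eq_smul_one`). [cite: Viviani2013, §2.1 Type I_{p,q}] -/
theorem forall_smul_eq_iff (hp : 0 < p) (hq : 0 < q) (g : stdSpecialUnitaryGroup p q) :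
    (∀ Z : unitaryPeriodDomain p q, g • Z = Z) ↔
      ∃ c : ℂ, ∀ x : Vp × Vq, (g : (Vp × Vq) ≃ₗ[ℂ] (Vp × Vq)) x = c • x :=
  ⟨exists_eq_smul_of_forall_smul_eq hp hq g, fun ⟨c, hc⟩ Z => smul_eq_self_of_eq_smul_one g c hc Z⟩

end Kernel

/-! ## §3 The scalars in `SU(p, q)`: `λ·1 ∈ SU(p, q) ↔ λ^{p+q} = 1` -/

section Scalars

/-- **If `λ·1 ∈ SU(p, q)` then `λ^{p+q} = 1`** (`det(λ·1) = λ^{dim} = λ^{p+q}`).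
[cite: Viviani2013, §2.1 Type I_{p,q} (`Z(SU(p,q)) = {λ I_{p+q} : λ^{p+q} = 1}`)] -/
theorem pow_eq_one_of_forall_eq_smul (g : stdSpecialUnitaryGroup p q) (c : ℂ)
    (hg : ∀ x : Vp × Vq, (g : (Vp × Vq) ≃ₗ[ℂ] (Vp × Vq)) x = c • x) : c ^ (p + q) = 1 := by
  have hdet := (mem_hermSpecialUnitaryGroup_iff.1 g.2).2
  have hlin : ((g : (Vp × Vq) ≃ₗ[ℂ] (Vp × Vq)) : (Vp × Vq) →ₗ[ℂ] (Vp × Vq)) =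
      c • (LinearMap.id : (Vp × Vq) →ₗ[ℂ] (Vp × Vq)) :=
    LinearMap.ext fun x => hg x
  rw [hlin, LinearMap.det_smul, LinearMap.det_id, mul_one, Module.finrank_prod, finrank_euclideanSpace_fin,
    finrank_euclideanSpace_fin] at hdet
  exact hdet

/-- **If `λ^{p+q} = 1` then `λ·1 ∈ SU(p, q)`** (`|λ| = 1` follows, so `λ·1` is an isometry, of
determinant `λ^{p+q} = 1`). [cite: Viviani2013, §2.1 Type I_{p,q} (`Z(SU(p,q)) = {λ I_{p+q} : λ^{p+q} = 1}`)] -/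
theorem exists_forall_eq_smul_of_pow_eq_one {c : ℂ} (hc : c ^ (p + q) = 1) :
    ∃ g : stdSpecialUnitaryGroup p q, ∀ x : Vp × Vq, (g : (Vp × Vq) ≃ₗ[ℂ] (Vp × Vq)) x = c • x := by
  rcases Nat.eq_zero_or_pos (p + q) with h0 | hpos
  · refine ⟨1, fun x => ?_⟩
    have hp : p = 0 := by omega
    have hq : q = 0 := by omega
    subst hp
    subst hq
    have hx : x = 0 := Subsingleton.elim _ _
    rw [hx, smul_zero, map_zero]
  · have hc0 : c ≠ 0 := by
      rintro rfl
      rw [zero_pow hpos.ne'] at hc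
      exact zero_ne_one hc
    have hc1 : ‖c‖ = 1 := Complex.norm_eq_one_of_pow_eq_one hc hpos.ne'
    refine ⟨⟨blockScalarEquiv c c hc0 hc0, mem_hermSpecialUnitaryGroup_iff.2 ⟨fun x y => ?_, ?_⟩⟩,
      fun x => rfl⟩
    · simp only [stdHermitianSesqForm_apply, blockScalarEquiv_apply]
      exact stdHermitianForm_smul_smul hc1 hc1 x y
    · rw [det_blockScalarEquiv, ← pow_add, hc]

end Scalars

/-! ## §4 The centre of `SU(p, q)`: it acts trivially, it is the kernel of the action, it is `μ_{p+q}·1` -/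

section Center

/-- Scalars are central: `λ·1 ∈ Z(SU(p, q))`. [cite: Viviani2013, §2.1 Type I_{p,q} (`Z(SU(p,q)) = {λ I_{p+q}}`)] -/
theorem mem_center_of_forall_eq_smul (g : stdSpecialUnitaryGroup p q) (c : ℂ)
    (hg : ∀ x : Vp × Vq, (g : (Vp × Vq) ≃ₗ[ℂ] (Vp × Vq)) x = c • x) :
    g ∈ Subgroup.center (stdSpecialUnitaryGroup p q) := by
  rw [Subgroup.mem_center_iff]
  intro h
  refine Subtype.ext (LinearEquiv.ext fun x => ?_)
  change ((h : (Vp × Vq) ≃ₗ[ℂ] (Vp × Vq)) * (g : (Vp × Vq) ≃ₗ[ℂ] (Vp × Vq))) x =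
    ((g : (Vp × Vq) ≃ₗ[ℂ] (Vp × Vq)) * (h : (Vp × Vq) ≃ₗ[ℂ] (Vp × Vq))) x
  rw [LinearEquiv.mul_apply, LinearEquiv.mul_apply, hg, hg, map_smul]

/-- A central element fixes the base point `0 ∈ I_{p,q}` (every `p, q`): `g • 0` is fixed by the whole
stabiliser `Stab(0)` (which commutes with `g`), hence is `0` by §1.
[cite: Viviani2013, §2.1 Type I_{p,q} ("the center […] acts trivially on `𝒟_{I_{p,q}}`")] -/
theorem smul_zeroPoint_of_mem_center {g : stdSpecialUnitaryGroup p q}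
    (hg : g ∈ Subgroup.center (stdSpecialUnitaryGroup p q)) : g • zeroPoint p q = zeroPoint p q := by
  refine eq_zeroPoint_of_forall_stabilizer_smul_eq fun k hk => ?_
  rw [MulAction.mem_stabilizer_iff] at hk
  rw [← mul_smul, Subgroup.mem_center_iff.1 hg k, mul_smul, hk]

/-- **The centre of `SU(p, q)` acts trivially on `I_{p,q}`** (every `p, q`): `g • (h • 0) = h • (g • 0) = h • 0`
and `SU(p, q)` is transitive. [cite: Viviani2013, §2.1 Type I_{p,q} ("Notice that the center […] of `SU(p,q)`
acts trivially on `𝒟_{I_{p,q}}`")] -/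
theorem smul_eq_self_of_mem_center {g : stdSpecialUnitaryGroup p q}
    (hg : g ∈ Subgroup.center (stdSpecialUnitaryGroup p q)) (Z : unitaryPeriodDomain p q) : g • Z = Z := by
  obtain ⟨h, rfl⟩ := MulAction.exists_smul_eq (stdSpecialUnitaryGroup p q) (zeroPoint p q) Z
  rw [← mul_smul, ← Subgroup.mem_center_iff.1 hg h, mul_smul, smul_zeroPoint_of_mem_center hg]

/-- `g` lies in the kernel of `SU(p, q) → Bij(I_{p,q})` iff it fixes every point.
[cite: Viviani2013, §2.1 Type I_{p,q}] -/
theorem mem_ker_toPermHom_iff (g : stdSpecialUnitaryGroup p q) :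
    g ∈ (MulAction.toPermHom (stdSpecialUnitaryGroup p q) (unitaryPeriodDomain p q)).ker ↔
      ∀ Z : unitaryPeriodDomain p q, g • Z = Z := by
  rw [MonoidHom.mem_ker, Equiv.Perm.ext_iff]
  exact Iff.rfl

/-- `Z(SU(p, q)) ≤ ker(SU(p, q) → Bij(I_{p,q}))` (every `p, q`).
[cite: Viviani2013, §2.1 Type I_{p,q} ("the center […] acts trivially")] -/
theorem center_le_ker :
    Subgroup.center (stdSpecialUnitaryGroup p q) ≤
      (MulAction.toPermHom (stdSpecialUnitaryGroup p q) (unitaryPeriodDomain p q)).ker :=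
  fun g hg => (mem_ker_toPermHom_iff g).2 (smul_eq_self_of_mem_center hg)

/-- **`Z(SU(p, q)) = ker(SU(p, q) → Bij(I_{p,q}))`** for `p, q ≥ 1` (`≥`: a trivially-acting element is a
scalar by §2, and scalars are central). [cite: Viviani2013, §2.1 Type I_{p,q}
("`Hol(𝒟_{I_{p,q}})ᵒ = SU(p,q)/Z(SU(p,q)) =: PSU(p,q)`")] -/
theorem center_eq_ker (hp : 0 < p) (hq : 0 < q) :
    Subgroup.center (stdSpecialUnitaryGroup p q) =
      (MulAction.toPermHom (stdSpecialUnitaryGroup p q) (unitaryPeriodDomain p q)).ker := by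
  refine le_antisymm center_le_ker fun g hg => ?_
  obtain ⟨c, hc⟩ := exists_eq_smul_of_forall_smul_eq hp hq g ((mem_ker_toPermHom_iff g).1 hg)
  exact mem_center_of_forall_eq_smul g c hc

/-- **`Z(SU(p, q)) = {λ I_{p+q} : λ^{p+q} = 1}`** (`p, q ≥ 1`): `g` is central iff `g = λ·1` with
`λ^{p+q} = 1`. [cite: Viviani2013, §2.1 Type I_{p,q} ("the center `Z(SU(p,q)) = {λ I_{p+q} : λ^{p+q} = 1}`")] -/
theorem mem_center_iff (hp : 0 < p) (hq : 0 < q) {g : stdSpecialUnitaryGroup p q} :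
    g ∈ Subgroup.center (stdSpecialUnitaryGroup p q) ↔
      ∃ c : ℂ, c ^ (p + q) = 1 ∧ ∀ x : Vp × Vq, (g : (Vp × Vq) ≃ₗ[ℂ] (Vp × Vq)) x = c • x := by
  constructor
  · intro hg
    obtain ⟨c, hc⟩ := exists_eq_smul_of_forall_smul_eq hp hq g (smul_eq_self_of_mem_center hg)
    exact ⟨c, pow_eq_one_of_forall_eq_smul g c hc, hc⟩
  · rintro ⟨c, -, hc⟩
    exact mem_center_of_forall_eq_smul g c hc

/-- Every `λ` with `λ^{p+q} = 1` occurs: `λ·1 ∈ Z(SU(p, q))`.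
[cite: Viviani2013, §2.1 Type I_{p,q} (`Z(SU(p,q)) = {λ I_{p+q} : λ^{p+q} = 1}`)] -/
theorem exists_mem_center_of_pow_eq_one {c : ℂ} (hc : c ^ (p + q) = 1) :
    ∃ g ∈ Subgroup.center (stdSpecialUnitaryGroup p q),
      ∀ x : Vp × Vq, (g : (Vp × Vq) ≃ₗ[ℂ] (Vp × Vq)) x = c • x := by
  obtain ⟨g, hg⟩ := exists_forall_eq_smul_of_pow_eq_one (p := p) (q := q) hc
  exact ⟨g, mem_center_of_forall_eq_smul g c hg, hg⟩

/-- The scalar of a scalar element is well defined (`p ≥ 1`: `ℂᵖ × ℂ^q ≠ 0`).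
[cite: Viviani2013, §2.1 Type I_{p,q} (`λ I_{p+q}`)] -/
theorem scalar_unique (hp : 0 < p) {g : stdSpecialUnitaryGroup p q} {c c' : ℂ}
    (hc : ∀ x : Vp × Vq, (g : (Vp × Vq) ≃ₗ[ℂ] (Vp × Vq)) x = c • x)
    (hc' : ∀ x : Vp × Vq, (g : (Vp × Vq) ≃ₗ[ℂ] (Vp × Vq)) x = c' • x) : c = c' := by
  set x₀ : Vp × Vq := (EuclideanSpace.single (⟨0, hp⟩ : Fin p) (1 : ℂ), 0) with hx₀
  have hx₀0 : x₀ ≠ 0 := by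
    intro h
    have h1 : ‖x₀.1‖ = 1 := by rw [hx₀, PiLp.norm_single, norm_one]
    rw [h, Prod.fst_zero, norm_zero] at h1
    exact zero_ne_one h1
  have h : (c - c') • x₀ = 0 := by rw [sub_smul, ← hc x₀, ← hc' x₀, sub_self]
  exact sub_eq_zero.1 ((smul_eq_zero.1 h).resolve_right hx₀0)

/-- **`Z(SU(p, q)) ≅ μ_{p+q}` has exactly `p + q` elements** (`p, q ≥ 1`): `g ↦ λ` (with `g = λ·1`) is a
bijection onto the `(p+q)`-th roots of unity in `ℂ`.
[cite: Viviani2013, §2.1 Type I_{p,q} ("`Z(SU(p,q)) = {λ I_{p+q} : λ^{p+q} = 1}`")] -/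
theorem card_center (hp : 0 < p) (hq : 0 < q) :
    Nat.card (Subgroup.center (stdSpecialUnitaryGroup p q)) = p + q := by
  haveI : NeZero (p + q) := ⟨by omega⟩
  have H : ∀ g : Subgroup.center (stdSpecialUnitaryGroup p q), ∃ c : ℂ, c ^ (p + q) = 1 ∧
      ∀ x : Vp × Vq, ((g : stdSpecialUnitaryGroup p q) : (Vp × Vq) ≃ₗ[ℂ] (Vp × Vq)) x = c • x :=
    fun g => (mem_center_iff hp hq).1 g.2
  choose c hc using H
  set f : Subgroup.center (stdSpecialUnitaryGroup p q) → rootsOfUnity (p + q) ℂ :=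
    fun g => rootsOfUnity.mkOfPowEq (c g) (hc g).1 with hf
  have hfinj : Function.Injective f := by
    intro g₁ g₂ h
    have hcc : c g₁ = c g₂ := by
      have h' := congrArg (fun ζ : rootsOfUnity (p + q) ℂ => ((ζ : ℂˣ) : ℂ)) h
      simpa only [hf, rootsOfUnity.coe_mkOfPowEq] using h'
    refine Subtype.ext (Subtype.ext (LinearEquiv.ext fun x => ?_))
    rw [(hc g₁).2, (hc g₂).2, hcc]
  have hfsurj : Function.Surjective f := by
    intro ζ
    have hζ : (((ζ : ℂˣ) : ℂ)) ^ (p + q) = 1 := (mem_rootsOfUnity' (p + q) (ζ : ℂˣ)).1 ζ.2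
    obtain ⟨g, hg, hgx⟩ := exists_mem_center_of_pow_eq_one (p := p) (q := q) hζ
    refine ⟨⟨g, hg⟩, Subtype.ext (Units.ext ?_)⟩
    rw [hf, rootsOfUnity.coe_mkOfPowEq]
    exact scalar_unique hp (hc ⟨g, hg⟩).2 hgx
  rw [Nat.card_congr (Equiv.ofBijective f ⟨hfinj, hfsurj⟩), Complex.card_rootsOfUnity]

end Center

/-! ## §5 `PSU(p, q) = SU(p, q)/Z(SU(p, q))` acts (effectively, for `p, q ≥ 1`) on `I_{p,q}` -/

section PSU

variable (p q)

/-- **`PSU(p, q) := SU(p, q)/Z(SU(p, q))`** (as printed). [cite: Viviani2013, §2.1 Type I_{p,q}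
("`SU(p,q)/Z(SU(p,q)) =: PSU(p,q)`")] -/
abbrev stdProjectiveSpecialUnitaryGroup : Type :=
  stdSpecialUnitaryGroup p q ⧸ Subgroup.center (stdSpecialUnitaryGroup p q)

/-- **The action of `SU(p, q)` on `I_{p,q}` descends to `PSU(p, q)`** (the centre acts trivially,
`center_le_ker`). [cite: Viviani2013, §2.1 Type I_{p,q} ("the center […] acts trivially on `𝒟_{I_{p,q}}`")] -/
instance instMulActionPSU : MulAction (stdProjectiveSpecialUnitaryGroup p q) (unitaryPeriodDomain p q) :=
  MulAction.compHom (unitaryPeriodDomain p q)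
    (QuotientGroup.lift (Subgroup.center (stdSpecialUnitaryGroup p q))
      (MulAction.toPermHom (stdSpecialUnitaryGroup p q) (unitaryPeriodDomain p q)) center_le_ker)

variable {p q}

/-- `[g] • Z = g • Z`. [cite: Viviani2013, §2.1 Type I_{p,q}] -/
@[simp] theorem PSU.coe_smul (g : stdSpecialUnitaryGroup p q) (Z : unitaryPeriodDomain p q) :
    (g : stdProjectiveSpecialUnitaryGroup p q) • Z = g • Z := rfl

/-- `PSU(p, q)` is transitive on `I_{p,q}` (as `SU(p, q)` is). [cite: Viviani2013, §2.1 Type I_{p,q}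
("`𝒟_{I_{p,q}} ≅ SU(p,q)/S(U_p × U_q) = PSU(p,q)/S̄(U_p × U_q)`")] -/
instance instIsPretransitivePSU :
    MulAction.IsPretransitive (stdProjectiveSpecialUnitaryGroup p q) (unitaryPeriodDomain p q) :=
  ⟨fun Z Z' => by
    obtain ⟨g, hg⟩ := MulAction.exists_smul_eq (stdSpecialUnitaryGroup p q) Z Z'
    exact ⟨(g : stdProjectiveSpecialUnitaryGroup p q), by rw [PSU.coe_smul, hg]⟩⟩

/-- **`PSU(p, q)` acts effectively on `I_{p,q}`** (`p, q ≥ 1`): two classes acting alike differ by an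
element of the kernel `= Z(SU(p, q))` (`center_eq_ker`). This is the injectivity of
`PSU(p,q) → Hol(𝒟_{I_{p,q}})`. [cite: Viviani2013, §2.1 Type I_{p,q} ("`Hol(𝒟_{I_{p,q}})ᵒ = SU(p,q)/Z(SU(p,q)) =: PSU(p,q)`")] -/
theorem faithfulSMul_PSU (hp : 0 < p) (hq : 0 < q) :
    FaithfulSMul (stdProjectiveSpecialUnitaryGroup p q) (unitaryPeriodDomain p q) := by
  refine ⟨fun {x y} h => ?_⟩
  obtain ⟨a, rfl⟩ := QuotientGroup.mk_surjective x
  obtain ⟨b, rfl⟩ := QuotientGroup.mk_surjective y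
  rw [QuotientGroup.eq, center_eq_ker hp hq, mem_ker_toPermHom_iff]
  intro Z
  rw [mul_smul, inv_smul_eq_iff]
  have hZ := h Z
  rw [PSU.coe_smul, PSU.coe_smul] at hZ
  exact hZ.symm

/-- `PSU(p, q)` acts effectively on `I_{p,q}` — instance form for numeral / `NeZero` sizes.
[cite: Viviani2013, §2.1 Type I_{p,q}] -/
instance instFaithfulSMulPSU [NeZero p] [NeZero q] :
    FaithfulSMul (stdProjectiveSpecialUnitaryGroup p q) (unitaryPeriodDomain p q) :=
  faithfulSMul_PSU (Nat.pos_of_ne_zero (NeZero.ne p)) (Nat.pos_of_ne_zero (NeZero.ne q))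

/-- In `PSU(p, q)` only the identity fixes all of `I_{p,q}` (`p, q ≥ 1`).
[cite: Viviani2013, §2.1 Type I_{p,q}] -/
theorem PSU.eq_one_of_forall_smul_eq (hp : 0 < p) (hq : 0 < q) (x : stdProjectiveSpecialUnitaryGroup p q)
    (hx : ∀ Z : unitaryPeriodDomain p q, x • Z = Z) : x = 1 := by
  haveI := faithfulSMul_PSU hp hq
  exact FaithfulSMul.eq_of_smul_eq_smul (M := stdProjectiveSpecialUnitaryGroup p q)
    (α := unitaryPeriodDomain p q) fun Z => by rw [hx Z, one_smul]

end PSU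

end Literature.AlgebraicGeometry.Motives
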